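import Summits.AtomisticToContinuum.BoseEinsteinCondensation.Theorems.BECThomsonPrincipleGDTransferSeededDefs
import Summits.AtomisticToContinuum.BoseEinsteinCondensation.Theorems.BECThomsonPrincipleGDTransferChordVariationSrcPair
import Summits.AtomisticToContinuum.BoseEinsteinCondensation.Theorems.BECHusimiAmplitudeGasPositivityReductionStability

/-!
# Route `BECThomsonPrinciple`, crux `GDTransfer` (stmt-AtomisticToContinuum-9482), line `seeded-continuity` —
# registered stub `stub_localConstancy`, part 2: near-minimisers are `L²`-close up to a phase; law stability

Supports (does not close) stmt-AtomisticToContinuum-9482; helper file of `stub_localConstancy`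
(`Theorems/BECThomsonPrincipleGDTransferSeededLocalConstancy.lean`).

* `seeded_nearMinimisers_phase_close` — at fixed `N ≥ 1` and side `L > 0`, for a measurable, bounded,
  finite-range pair potential and every `η > 0` there is `δ > 0` such that ANY TWO `δ`-near-minimisers
  `Ψ, Φ` of the periodic `N`-body energy satisfy `∫_{cell^N} |Ψ - cΦ|² ≤ η²` for a phase `c`, `|c| = 1`.
  This is the first half of the tree's `condensateOccupation_le_of_nearMinimisers`
  (`Theorems/BECHusimiAmplitudeGasPositivityReductionStability.lean`), extracted verbatim: min–max in the
  form domain (`TwoModeData` of `formEmbed`, `E₀ = κ₁⁻¹ - 1`), the spectral gap `κ₁⁻¹ < κ₂⁻¹` from the PROVED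
  nondegeneracy of the bosonic torus ground state (`PeriodicGroundStateNondegenerate_holds`), and the two-sided
  phase alignment `twoModeData_exists_phase_norm_sub_sq_le_of_near` with `δ = gap·η²/8`.
* `periodicGroundStateEnergy_ne_top_of_bounded` — `E₀(N, L) < ∞` for such potentials (`E₀ = κ₁⁻¹ - 1`).
* `compMass_const_mul` — phase covariance of the component masses, `w_S(cψ) = |c|² w_S(ψ)`.
* `lawMass_le_of_nearMinimisers` — **law stability at fixed `(N, L)`**: given the `L²`-Lipschitz bound of
  the law (`CountLaw` (2), a HYPOTHESIS here — it is the registered stub `stub_countLaw`), any two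
  `δ`-near-minimisers have every partial law `Σ_{|S|∈A} w_S` within `ε`.
-/

noncomputable section

open MeasureTheory Filter Set Complex
open scoped ENNReal NNReal Topology ComplexConjugate InnerProductSpace

namespace Summit.AtomisticToContinuum.BoseEinsteinCondensation.Cruxes.GDTransfer.Seeded

open Literature.MathematicalPhysics.QuantumManyBody.BoseGas Literature.Analysis.InnerProduct
  Literature.MathematicalPhysics.QuantumManyBody
open Summit.AtomisticToContinuum.BoseEinsteinCondensation.Theorems
open Summit.AtomisticToContinuum.BoseEinsteinCondensation.Theorems.GaussianDominationCan.Negative (modeProj)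
open Summit.AtomisticToContinuum.BoseEinsteinCondensation.Cruxes.GDTransfer.DysonDressedWitness.ChordVariation
  (modeProj_const_mul continuous_modeProj)

/-! ## Two near-minimisers are `L²`-close up to a phase -/

/-- **Two near-minimisers of the periodic `N`-body energy are `L²(cell)`-close up to a phase**
(registered helper of `stub_localConstancy`). For a measurable pair potential `v ≥ 0` of finite range
(`v(r) = 0` for `r > R₀`) and bounded (`v ≤ M`), `N = n + 1`, `L > 0` and `η > 0`, there is `δ > 0` such that
any two `δ`-near-minimisers `Ψ, Φ` satisfy `∫_{cell^N} |Ψ - cΦ|² ≤ η²` for some `c ∈ ℂ`, `|c| = 1`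
(spectral gap from `PeriodicGroundStateNondegenerate_holds`, two-sided phase alignment, `δ = gap·η²/8`).
[cite: ReedSimonIV1978, Thm. XIII.1 and §XIII.12 Thms XIII.43–XIII.46] -/
theorem seeded_nearMinimisers_phase_close : ∀ (v : ℝ → ENNReal), Measurable v → ∀ R₀ : ℝ, (∀ r, R₀ < r → v r = 0) → ∀ M : NNReal, (∀ r, v r ≤ M) → ∀ (n : ℕ) (L : ℝ), 0 < L → ∀ η : ℝ, 0 < η → ∃ δ : ENNReal, 0 < δ ∧ ∀ Ψ Φ : Literature.MathematicalPhysics.QuantumManyBody.BoseGas.PeriodicTrialState (n + 1) L, Literature.MathematicalPhysics.QuantumManyBody.BoseGas.periodicEnergy v Ψ ≤ Literature.MathematicalPhysics.QuantumManyBody.BoseGas.periodicGroundStateEnergy v (n + 1) L + δ → Literature.MathematicalPhysics.QuantumManyBody.BoseGas.periodicEnergy v Φ ≤ Literature.MathematicalPhysics.QuantumManyBody.BoseGas.periodicGroundStateEnergy v (n + 1) L + δ → ∃ c : ℂ, ‖c‖ = 1 ∧ ∫⁻ X in Literature.MathematicalPhysics.QuantumManyBody.BoseGas.cellN (n + 1)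 L, (‖Ψ.ψ X - c * Φ.ψ X‖₊ : ENNReal) ^ 2 ≤ ENNReal.ofReal (η ^ 2) := by
  -- adapted from `condensateOccupation_le_of_nearMinimisers` (Theorems/BECHusimiAmplitudeGasPositivityReductionStability.lean)
  intro v hmeas R₀ hR₀ M hM n L hL η hη0
  -- bounded periodisation, `W ∈ L¹(cell)`
  obtain ⟨C, hC⟩ := exists_bound_periodizedPotential hL hM hR₀
  have hW : ∫⁻ X in cellN (n + 1) L, periodicInteraction v L X ≠ ⊤ :=
    lintegral_periodicInteraction_ne_top hC (n + 1)
  -- the graph map into the form domain `Q` and the embedding `ι : Q → H = L²`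
  set J := (graphEmbed hL hmeas hW).codRestrict (formDomain hL hmeas hW)
    (graphEmbed_mem_formDomain hL hmeas hW) with hJ
  have hJapply : ∀ F : periodicCore (n + 1) L,
      J F = ⟨graphEmbed hL hmeas hW F, graphEmbed_mem_formDomain hL hmeas hW F⟩ := fun F => rfl
  set ι := formEmbed hL hmeas hW with hι
  -- spectral data of the two lowest eigenvalues, and the gap
  obtain ⟨d⟩ := nonempty_twoModeData hL hmeas hW (Nat.succ_pos n)
  have hE₀ : periodicGroundStateEnergy v (n + 1) L = ENNReal.ofReal (d.κ₁⁻¹ - 1) :=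
    periodicGroundStateEnergy_eq_ofReal d
  have h1 : 1 ≤ d.κ₁⁻¹ := twoModeData_one_le_inv_κ₁ d
  have hgap : d.κ₁⁻¹ < d.κ₂⁻¹ := by
    have hlt := PeriodicGroundStateNondegenerate_holds (n + 1) L v (Nat.succ_pos n) hL hmeas ⟨C, hC⟩
    rw [hE₀, kyFanTwo_eq_ofReal d,
      show (2 : ℝ≥0∞) * ENNReal.ofReal (d.κ₁⁻¹ - 1) = ENNReal.ofReal (2 * (d.κ₁⁻¹ - 1)) by
        rw [ENNReal.ofReal_mul zero_le_two, ENNReal.ofReal_ofNat],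
      ENNReal.ofReal_lt_ofReal_iff_of_nonneg (by linarith)] at hlt
    linarith
  have hg0 : 0 < d.κ₂⁻¹ - d.κ₁⁻¹ := sub_pos.2 hgap
  refine ⟨ENNReal.ofReal ((d.κ₂⁻¹ - d.κ₁⁻¹) * (η ^ 2 / 8)),
    ENNReal.ofReal_pos.2 (by positivity), fun Ψ Φ hΨ hΦ => ?_⟩
  -- the vectors
  set FΨ : periodicCore (n + 1) L := ⟨Ψ.ψ, Ψ.mem_periodicCore⟩ with hFΨ
  set FΦ : periodicCore (n + 1) L := ⟨Φ.ψ, Φ.mem_periodicCore⟩ with hFΦ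
  have huΨ : ‖ι (J FΨ)‖ = 1 := norm_formEmbed_graphEmbed_trialState hL hmeas hW Ψ
  have huΦ : ‖ι (J FΦ)‖ = 1 := norm_formEmbed_graphEmbed_trialState hL hmeas hW Φ
  have hnormJ : ∀ F : periodicCore (n + 1) L, ‖J F‖ = ‖graphEmbed hL hmeas hW F‖ := fun F => by
    rw [hJapply]; rfl
  have hQΨ : ‖J FΨ‖ ^ 2 = 1 + (periodicEnergy v Ψ).toReal := by
    rw [hnormJ]; exact norm_graphEmbed_sq_trialState hL hmeas hW Ψ
  have hQΦ : ‖J FΦ‖ ^ 2 = 1 + (periodicEnergy v Φ).toReal := by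
    rw [hnormJ]; exact norm_graphEmbed_sq_trialState hL hmeas hW Φ
  -- energies as real numbers
  have hEreal : ∀ {Θ : PeriodicTrialState (n + 1) L},
      periodicEnergy v Θ ≤ periodicGroundStateEnergy v (n + 1) L +
        ENNReal.ofReal ((d.κ₂⁻¹ - d.κ₁⁻¹) * (η ^ 2 / 8)) →
      (periodicEnergy v Θ).toReal ≤ d.κ₁⁻¹ - 1 + (d.κ₂⁻¹ - d.κ₁⁻¹) * (η ^ 2 / 8) := by
    intro Θ hΘ
    rw [hE₀, ← ENNReal.ofReal_add (by linarith) (by positivity)] at hΘ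
    have := ENNReal.toReal_mono ENNReal.ofReal_ne_top hΘ
    rwa [ENNReal.toReal_ofReal (by nlinarith [sq_nonneg η])] at this
  have hEΨ := hEreal hΨ
  have hEΦ := hEreal hΦ
  -- the abstract stability argument: `‖ιΨ - c'•ιΦ‖² ≤ η²`
  obtain ⟨c', hc', hdist'⟩ := twoModeData_exists_phase_norm_sub_sq_le_of_near (ι := ι) d hgap
    (u := J FΨ) (w := J FΦ) huΨ huΦ (t := η ^ 2 / 4) (by positivity) (by linarith) (by linarith)
  have hdist : ‖ι (J FΨ) - c' • ι (J FΦ)‖ ^ 2 ≤ η ^ 2 := by linarith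
  -- back to functions on the cell: `∫_cell |Ψ - c'Φ|² ≤ η²`
  have hcore : ι (J FΨ) - c' • ι (J FΦ) = ι (J (FΨ - c' • FΦ)) := by
    simp only [map_sub, map_smul]
  have hfun : ((FΨ - c' • FΦ : periodicCore (n + 1) L) : Config (n + 1) → ℂ) =
      fun X => Ψ.ψ X - c' * Φ.ψ X := by
    ext X
    simp [hFΨ, hFΦ]
  have hcontd : Continuous fun X => Ψ.ψ X - c' * Φ.ψ X :=
    Ψ.contDiff.continuous.sub (continuous_const.mul Φ.contDiff.continuous)
  refine ⟨c', hc', ?_⟩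
  have hnorm : ‖ι (J (FΨ - c' • FΦ))‖ ^ 2 =
      (∫⁻ X in cellN (n + 1) L,
        (‖((FΨ - c' • FΦ : periodicCore (n + 1) L) : Config (n + 1) → ℂ) X‖₊ : ℝ≥0∞) ^ 2).toReal :=
    norm_formEmbed_graphEmbed_sq hL hmeas hW (FΨ - c' • FΦ)
  simp only [hfun, ← hcore] at hnorm
  have hfin' : (∫⁻ X in cellN (n + 1) L, (‖Ψ.ψ X - c' * Φ.ψ X‖₊ : ℝ≥0∞) ^ 2) ≠ ⊤ :=
    (lintegral_cellN_sq_lt_top L hcontd).ne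
  rw [← ENNReal.ofReal_toReal hfin', ← hnorm]
  exact ENNReal.ofReal_le_ofReal hdist

/-- **The periodic ground-state energy is finite** for a measurable bounded finite-range pair potential,
`N ≥ 1` particles and side `L > 0`: `E₀ = κ₁⁻¹ - 1` in the form-domain spectral dictionary.
[cite: ReedSimonIV1978, Thm. XIII.1] -/
theorem periodicGroundStateEnergy_ne_top_of_bounded {v : ℝ → ℝ≥0∞} (hmeas : Measurable v) {R₀ : ℝ}
    (hR₀ : ∀ r, R₀ < r → v r = 0) {M : ℝ≥0} (hM : ∀ r, v r ≤ M) (n : ℕ) {L : ℝ} (hL : 0 < L) :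
    periodicGroundStateEnergy v (n + 1) L ≠ ⊤ := by
  obtain ⟨C, hC⟩ := exists_bound_periodizedPotential hL hM hR₀
  have hW : ∫⁻ X in cellN (n + 1) L, periodicInteraction v L X ≠ ⊤ :=
    lintegral_periodicInteraction_ne_top hC (n + 1)
  obtain ⟨d⟩ := nonempty_twoModeData hL hmeas hW (Nat.succ_pos n)
  rw [periodicGroundStateEnergy_eq_ofReal d]
  exact ENNReal.ofReal_ne_top

/-! ## Law stability at fixed `(N, L)` -/

/-- **Phase covariance of the component masses**: `w_S(cψ) = |c|² w_S(ψ)` (`Q_S` is homogeneous).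
[folklore] -/
theorem compMass_const_mul (m : ℕ) (L : ℝ) (S : Finset (Fin (m + 1))) (c : ℂ)
    (ψ : Config (m + 1) → ℂ) :
    compMass m L S (fun X => c * ψ X) = (‖c‖₊ : ℝ≥0∞) ^ 2 * compMass m L S ψ := by
  unfold compMass
  rw [modeProj_const_mul S c ψ]
  simp only [nnnorm_mul, ENNReal.coe_mul, mul_pow]
  exact lintegral_const_mul' _ _ (ENNReal.pow_ne_top ENNReal.coe_ne_top)

/-- A phase does not change the component masses: `w_S(cψ) = w_S(ψ)` for `|c| = 1`. [folklore] -/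
theorem compMass_phase_mul (m : ℕ) (L : ℝ) (S : Finset (Fin (m + 1))) {c : ℂ} (hc : ‖c‖ = 1)
    (ψ : Config (m + 1) → ℂ) :
    compMass m L S (fun X => c * ψ X) = compMass m L S ψ := by
  have hcn : ((‖c‖₊ : ℝ≥0) : ℝ≥0∞) = 1 := by
    rw [← ENNReal.coe_one, ENNReal.coe_inj, ← NNReal.coe_inj, coe_nnnorm, hc, NNReal.coe_one]
  rw [compMass_const_mul, hcn, one_pow, one_mul]

/-- **Law stability between two near-minimisers at fixed `(N, L)`.** Assume the `L²`-Lipschitz bound of the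
law (`CountLaw`). For a measurable bounded finite-range pair potential `u`, `N = m + 1`, `L > 0`, a set of
counts `A` and `ε > 0` there is `δ > 0` such that any two `δ`-near-minimisers `Θ, Ξ` satisfy
`P_Θ(n̂₀ ∈ A) ≤ P_Ξ(n̂₀ ∈ A) + ε`: with `η = min(ε/3, 1)` (`2η + η² ≤ ε`), `Θ` is within `η` of `cΞ` in
`L²(cell)` for a phase `c` (`seeded_nearMinimisers_phase_close`), the law of `cΞ` is that of `Ξ`
(`compMass_phase_mul`), and the Lipschitz bound applies (`∫|cΞ|² = 1`). [folklore] -/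
theorem lawMass_le_of_nearMinimisers (hC : CountLaw) {u : ℝ → ℝ≥0∞} (hmeas : Measurable u) {R₀ : ℝ}
    (hR₀ : ∀ r, R₀ < r → u r = 0) {M : ℝ≥0} (hM : ∀ r, u r ≤ M) (m : ℕ) {L : ℝ} (hL : 0 < L)
    (p : ℕ → Prop) [DecidablePred p] {ε : ℝ} (hε : 0 < ε) :
    ∃ δ : ℝ≥0∞, 0 < δ ∧ ∀ Θ Ξ : PeriodicTrialState (m + 1) L,
      periodicEnergy u Θ ≤ periodicGroundStateEnergy u (m + 1) L + δ →
      periodicEnergy u Ξ ≤ periodicGroundStateEnergy u (m + 1) L + δ →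
      lawMass m L p Θ.ψ ≤ lawMass m L p Ξ.ψ + ENNReal.ofReal ε := by
  -- the tolerance
  set η : ℝ := min (ε / 3) 1 with hη
  have hη0 : 0 < η := lt_min (by linarith) one_pos
  have hηε : 2 * η + η ^ 2 ≤ ε := by nlinarith [min_le_left (ε / 3) 1, min_le_right (ε / 3) 1]
  obtain ⟨δ, hδ0, hδ⟩ := seeded_nearMinimisers_phase_close u hmeas R₀ hR₀ M hM m L hL η hη0
  refine ⟨δ, hδ0, fun Θ Ξ hΘ hΞ => ?_⟩
  obtain ⟨c, hc, hcell⟩ := hδ Θ Ξ hΘ hΞ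
  -- the Lipschitz bound of the law between `Θ` and `cΞ`
  have hcn : ((‖c‖₊ : ℝ≥0) : ℝ≥0∞) = 1 := by
    rw [← ENNReal.coe_one, ENNReal.coe_inj, ← NNReal.coe_inj, coe_nnnorm, hc, NNReal.coe_one]
  have hcontg : Continuous fun X => c * Ξ.ψ X := continuous_const.mul Ξ.contDiff.continuous
  have hg1 : ∫⁻ X in cellN (m + 1) L, (‖c * Ξ.ψ X‖₊ : ℝ≥0∞) ^ 2 ≤ 1 := by
    have hX : ∀ X, (‖c * Ξ.ψ X‖₊ : ℝ≥0∞) ^ 2 = (‖Ξ.ψ X‖₊ : ℝ≥0∞) ^ 2 := fun X => by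
      rw [nnnorm_mul, ENNReal.coe_mul, mul_pow, hcn, one_pow, one_mul]
    simp only [hX]
    rw [Ξ.norm_eq]
  have hmain := hC.2 m L hL ((Finset.univ : Finset (Finset (Fin (m + 1)))).filter fun S => p S.card)
    Θ.ψ (fun X => c * Ξ.ψ X) Θ.contDiff.continuous hcontg hg1 η hη0 hcell
  have hphase : ∀ S : Finset (Fin (m + 1)), compMass m L S (fun X => c * Ξ.ψ X) = compMass m L S Ξ.ψ :=
    fun S => compMass_phase_mul m L S hc Ξ.ψ
  simp only [hphase] at hmain
  exact hmain.trans (add_le_add le_rfl (ENNReal.ofReal_le_ofReal hηε))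

end Summit.AtomisticToContinuum.BoseEinsteinCondensation.Cruxes.GDTransfer.Seeded

end
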